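import Summits.ResolutionOfSingularities.ResolutionOfSingularities.Theorems.HypersurfaceCentreConstruction.Negative.CanonicalGameFalseOfForcedDescentChain
import Summits.ResolutionOfSingularities.ResolutionOfSingularities.Theorems.HypersurfaceCentreConstruction.Negative.CanonicalGameFalseOfClosedFamily
import Summits.ResolutionOfSingularities.ResolutionOfSingularities.Theorems.WeightedInvariantHypersurfaceLocalGameEFT4SSeams
import Literature.AlgebraicGeometry.Resolution.MonomializationAlongValuation

/-!
# `HypersurfaceCentreConstruction` — negative lemmas repaired: only the MINIMAL moves have to be answered

Door crux `stmt-ResolutionOfSingularities-19897`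
(`Summit.ResolutionOfSingularities.ResolutionOfSingularities.Theses.WeightedInvariant.HypersurfaceCentreConstruction`, route
`ResolutionOfSingularities/WeightedInvariant`, line `local-engine`, skeleton v3.3, key stub `stub_localWeightedDropEFT4S` over
`…HypersurfaceLocalGameEFT3` (p501595) / `…EFT4S` (p504475)).  res-L1-w43-plan-1 ORDER (o27) executing RULING (D15) (HOME/STATUS
2026-08-27T07:23:32Z) on res-L1-w43-tri-2's objection A-v5.2 (L/res-L1-w43-tri-2/TRIAGE.md `0d5fb16519ddfe44`); typed by res-type-070.
No definitions, proofs only.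

[OURS · L1 W4.3 · AI-produced negative knowledge, weaker than expert review; nothing here asserts anything about Hironaka's problem.]

WHAT WAS WRONG (tri-2 A-v5.2, upheld as RULING (D15)).  The two landed kill templates of res-L1-w43-tri-1,
`canonicalGameClause_false_of_forcedDescentChain` (`…/Negative/CanonicalGameFalseOfForcedDescentChain.lean`, p507616) and
`canonicalGameClause_false_of_closedFamily` (`…/Negative/CanonicalGameFalseOfClosedFamily.lean`, p508704), are kernel-true but their
family hypotheses `hchain` / `hclosed` ask the adversary to answer EVERY presented weighted tuple `(P, n, u, w)` with `span (range u) = 𝔪`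
— including the junk move `u := (x₁, …, x_d, f)`, `w := (1, …, 1, N)`, `N ≥ ν + 1`, whose only `t⁻¹`-saturated factor `g = f tᴺ` is a unit or a
regular parameter at every prime of the exceptional fibre, so that the required singular successor never exists: the hypotheses are
unsatisfiable at every position and both theorems quantify over the empty family.  The clause (c9′) `CanonicalGameClause` itself never
plays that move: it presents the centre on a MINIMAL system (`(maximalIdeal S).spanFinrank = n`), through a regular centre
(`IsRegularLocalRing (S ⧸ P)`), admissible along the whole centre ((adm) `f ∈ 𝔪_Q²` for every prime `Q ⊇ P`) — exactly the components the
original `obtain`s discarded.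

THIS FILE = the same two theorems with the family hypothesis RESTRICTED to the moves the clause can actually play: the premises of
`hchain` / `hclosed` now carry, in the clause's own order, `IsRegularLocalRing (S ⧸ P)`, the MANDATORY minimality conjunct
`(maximalIdeal S).spanFinrank = n`, and (adm).  The proofs are tri-1's with the three discarded `obtain` components threaded; the extra
premises only weaken the hypothesis, so these forms imply the originals.

* `ne_of_span_eq_maximalIdeal_of_spanFinrank_eq` — sanity: under the minimality conjunct no member of `u` lies in `𝔪²`; in particular the
  junk move `u = (r.s.p., f)` is not a minimal move (tree lemma `Literature.AlgebraicGeometry.Resolution.not_mem_sq_of_span_eq_maximalIdeal`).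
* `canonicalGameClause_false_of_forcedMinimalDescentChain` — LINEAR case: a sequence of e.f.t. positions `(S i, f i)` over one perfect
  field of characteristic `p` in which every MINIMAL admissible move at position `i` has a singular successor off the vertex over the
  centre whose position is, up to a ring isomorphism, an essentially smooth local pull-back of position `i + 1`, refutes
  `CanonicalGameClause p ι J` for every `(ι, J)` with (c6) `IotaIsoInvariant ι` and (c11) `IotaJEssSmoothCompatible ι J`
  (`i ↦ ι (S i) (f i)` would strictly decrease in `Ordinal`).
* `canonicalGameClause_false_of_closedMinimalFamily` — TREE case: a non-empty family of singular e.f.t. positions closed under answering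
  minimal moves (different moves may lead to different members) refutes the clause (least-`ι` member, `WellFounded.not_lt_min`).
* `localWeightedDropEFT3_false_of_forcedMinimalDescentChain`, `localWeightedDropEFT3_false_of_closedMinimalFamily` — projections to the
  keyed candidate H2a‴ `LocalWeightedDropEFT3 p`; `localWeightedDropEFT4S_false_of_forcedMinimalDescentChain`,
  `localWeightedDropEFT4S_false_of_closedMinimalFamily` — the registered key H2a⁗ `LocalWeightedDropEFT4S p`, via the by-name seam
  `not_eft4S_of_not_eft3` (`…LocalGameEFT4SSeams`, p508387).

No chain or family is claimed to exist.  These are the forms a descent census (res-L1-w43-idea-2, tri-1) must instantiate: a kill of the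
key needs a family of positions in which every MINIMAL regular-centre admissible move is answered inside the family.
-/

noncomputable section

open IsLocalRing AlgebraicGeometry CategoryTheory Literature.AlgebraicGeometry.Resolution
open Summit.ResolutionOfSingularities.ResolutionOfSingularities.Cruxes.HypersurfaceCentreConstruction.LocalEngine

set_option linter.dupNamespace false

namespace Summit.ResolutionOfSingularities.ResolutionOfSingularities.Theorems.HypersurfaceCentreConstruction.Negative

/-- **The junk move is not a minimal move.**  In a Noetherian local ring, if `u : Fin n → S` spans `𝔪` and `n` is the minimal
number of generators (`(maximalIdeal S).spanFinrank = n`, the minimality conjunct of (c9′)), then no `u j` equals an element of `𝔪²` —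
so tri-2's move `u = (x₁, …, x_d, f)` with `f ∈ 𝔪²` (A-v5.2) is excluded by the repaired hypotheses below (Nakayama; tree lemma
`not_mem_sq_of_span_eq_maximalIdeal`). [folklore] -/
theorem ne_of_span_eq_maximalIdeal_of_spanFinrank_eq {S : Type} [CommRing S] [IsLocalRing S] [IsNoetherianRing S]
    {n : ℕ} {u : Fin n → S} (hspan : Ideal.span (Set.range u) = maximalIdeal S)
    (hrank : (maximalIdeal S).spanFinrank = n) {f : S} (hf2 : f ∈ (maximalIdeal S) ^ 2) (j : Fin n) :
    u j ≠ f := by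
  classical
  intro h
  have hs : Ideal.span ((Finset.univ.image u : Finset S) : Set S) = maximalIdeal S := by
    rw [Finset.coe_image, Finset.coe_univ, Set.image_univ, hspan]
  have hcard : (Finset.univ.image u).card ≤ (maximalIdeal S).spanFinrank := by
    rw [hrank]
    exact (Finset.card_image_le).trans (by simp)
  have hmem : u j ∈ Finset.univ.image u := Finset.mem_image_of_mem u (Finset.mem_univ j)
  exact not_mem_sq_of_span_eq_maximalIdeal _ hs hcard hmem (h ▸ hf2)

/-- **A forced descent chain through MINIMAL moves kills the canonical game clause** for every `(ι, J)` with (c6) and (c11)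
(RULING (D15) form of tri-1's `canonicalGameClause_false_of_forcedDescentChain`).  `hchain`: at every position `i`, every move the
clause can play — a prime `P ∋ f i` with `S i ⧸ P` regular, a MINIMAL system `u` of `𝔪` (`span (range u) = 𝔪`,
`𝔪.spanFinrank = n`), weights `w` not all zero whose positively weighted members span `P`, admissible along the centre ((adm):
`f i ∈ 𝔪_Q²` for every prime `Q ⊇ P`) — has a prime `𝔫` of `B = cobordantAlgebra' u w` with `t⁻¹ ∈ 𝔫 ⊇ P·B`, off the vertex, a
`t⁻¹`-saturated factor `g` of `f i` singular at `𝔫`, and a ring isomorphism of `B_𝔫` with an essentially smooth local extension `S'` of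
`S (i+1)` carrying `g` to `f (i+1) ⊗ 1`.  Proof: (c9′) supplies such a move with the `ι`-drop at all its singular successors; `hchain`
answers it with a successor carrying, by (c6) + (c11), the value `ι (S (i+1)) (f (i+1))`; so `i ↦ ι (S i) (f i)` is a strictly
decreasing sequence of ordinals. [folklore] -/
theorem canonicalGameClause_false_of_forcedMinimalDescentChain (p : ℕ) (ι : (R : Type) → [CommRing R] → R → Ordinal.{0})
    (J : (R : Type) → [CommRing R] → R → ℕ → Ideal R)
    (h6 : IotaIsoInvariant ι) (h11 : IotaJEssSmoothCompatible ι J)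
    (k₀ : Type) [Field k₀] [CharP k₀ p] [PerfectField k₀]
    (S : ℕ → Type) [∀ i, CommRing (S i)] [∀ i, Algebra k₀ (S i)] [∀ i, Algebra.EssFiniteType k₀ (S i)]
    [∀ i, IsRegularLocalRing (S i)] (f : ∀ i, S i) (hf0 : ∀ i, f i ≠ 0) (hf2 : ∀ i, f i ∈ (maximalIdeal (S i)) ^ 2)
    (hchain : ∀ (i : ℕ) (P : Ideal (S i)) (n : ℕ) (u : Fin n → S i) (w : Fin n → ℕ),
      P.IsPrime → IsRegularLocalRing (S i ⧸ P) → f i ∈ P →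
      Ideal.span (Set.range u) = maximalIdeal (S i) → (maximalIdeal (S i)).spanFinrank = n → (∃ j, 0 < w j) →
      Ideal.span {x | ∃ j, 0 < w j ∧ x = u j} = P →
      (∀ (Q : Ideal (S i)) [Q.IsPrime], P ≤ Q →
        algebraMap (S i) (Localization.AtPrime Q) (f i) ∈ (maximalIdeal (Localization.AtPrime Q)) ^ 2) →
      ∃ (𝔫 : Ideal (cobordantAlgebra' u w)) (_ : 𝔫.IsPrime),
        cobordantT' u w ∈ 𝔫 ∧ P.map (algebraMap (S i) (cobordantAlgebra' u w)) ≤ 𝔫 ∧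
        ¬ (extReesAlgebra.vertexIdeal (weightedMonomialIdeal u w) ≤ 𝔫) ∧
        ∃ (a : ℕ) (g : cobordantAlgebra' u w),
          algebraMap (S i) (cobordantAlgebra' u w) (f i) = cobordantT' u w ^ a * g ∧ ¬ (cobordantT' u w ∣ g) ∧
          algebraMap (cobordantAlgebra' u w) (Localization.AtPrime 𝔫) g ∈ (maximalIdeal (Localization.AtPrime 𝔫)) ^ 2 ∧
          ∃ (S' : Type) (_ : CommRing S') (_ : IsRegularLocalRing S') (_ : Algebra (S (i + 1)) S')
            (_ : IsLocalHom (algebraMap (S (i + 1)) S')) (_ : Algebra.FormallySmooth (S (i + 1)) S')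
            (_ : Algebra.EssFiniteType (S (i + 1)) S') (e : Localization.AtPrime 𝔫 ≃+* S'),
            e (algebraMap (cobordantAlgebra' u w) (Localization.AtPrime 𝔫) g) = algebraMap (S (i + 1)) S' (f (i + 1))) :
    ¬ CanonicalGameClause p ι J := by
  intro hgame
  have hlt : ∀ i : ℕ, ι (S (i + 1)) (f (i + 1)) < ι (S i) (f i) := by
    intro i
    obtain ⟨P, hP, hPreg, hfP, -, -, n, u, w, hspan, hrank, hpos, hcentre, -, hadm, hdrop⟩ :=
      hgame k₀ (S i) (f i) (hf0 i) (hf2 i)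
    obtain ⟨𝔫, h𝔫, ht, hP𝔫, hv, a, g, hfg, hndvd, hg2, S', _, _, _, _, _, _, e, he⟩ :=
      hchain i P n u w hP hPreg hfP hspan hrank hpos hcentre (fun Q _ hQ => hadm Q hQ)
    have h := hdrop 𝔫 ht hP𝔫 hv a g hfg hndvd hg2
    have h1 : ι S' (e (algebraMap (cobordantAlgebra' u w) (Localization.AtPrime 𝔫) g)) =
        ι (Localization.AtPrime 𝔫) (algebraMap (cobordantAlgebra' u w) (Localization.AtPrime 𝔫) g) :=
      h6 (Localization.AtPrime 𝔫) S' e (algebraMap (cobordantAlgebra' u w) (Localization.AtPrime 𝔫) g)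
    have h2 : ι S' (algebraMap (S (i + 1)) S' (f (i + 1))) = ι (S (i + 1)) (f (i + 1)) :=
      (h11 (S (i + 1)) S' (f (i + 1))).1
    rw [← h1, he, h2] at h
    exact h
  exact (RelEmbedding.natGT (fun i => ι (S i) (f i)) hlt).not_wellFounded wellFounded_lt

/-- Corollary (projection to (c6), (c11), (c9′)): a forced descent chain through minimal moves in characteristic `p` refutes
H2a‴ `LocalWeightedDropEFT3 p`. [folklore] -/
theorem localWeightedDropEFT3_false_of_forcedMinimalDescentChain (p : ℕ)
    (k₀ : Type) [Field k₀] [CharP k₀ p] [PerfectField k₀]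
    (S : ℕ → Type) [∀ i, CommRing (S i)] [∀ i, Algebra k₀ (S i)] [∀ i, Algebra.EssFiniteType k₀ (S i)]
    [∀ i, IsRegularLocalRing (S i)] (f : ∀ i, S i) (hf0 : ∀ i, f i ≠ 0) (hf2 : ∀ i, f i ∈ (maximalIdeal (S i)) ^ 2)
    (hchain : ∀ (i : ℕ) (P : Ideal (S i)) (n : ℕ) (u : Fin n → S i) (w : Fin n → ℕ),
      P.IsPrime → IsRegularLocalRing (S i ⧸ P) → f i ∈ P →
      Ideal.span (Set.range u) = maximalIdeal (S i) → (maximalIdeal (S i)).spanFinrank = n → (∃ j, 0 < w j) →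
      Ideal.span {x | ∃ j, 0 < w j ∧ x = u j} = P →
      (∀ (Q : Ideal (S i)) [Q.IsPrime], P ≤ Q →
        algebraMap (S i) (Localization.AtPrime Q) (f i) ∈ (maximalIdeal (Localization.AtPrime Q)) ^ 2) →
      ∃ (𝔫 : Ideal (cobordantAlgebra' u w)) (_ : 𝔫.IsPrime),
        cobordantT' u w ∈ 𝔫 ∧ P.map (algebraMap (S i) (cobordantAlgebra' u w)) ≤ 𝔫 ∧
        ¬ (extReesAlgebra.vertexIdeal (weightedMonomialIdeal u w) ≤ 𝔫) ∧
        ∃ (a : ℕ) (g : cobordantAlgebra' u w),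
          algebraMap (S i) (cobordantAlgebra' u w) (f i) = cobordantT' u w ^ a * g ∧ ¬ (cobordantT' u w ∣ g) ∧
          algebraMap (cobordantAlgebra' u w) (Localization.AtPrime 𝔫) g ∈ (maximalIdeal (Localization.AtPrime 𝔫)) ^ 2 ∧
          ∃ (S' : Type) (_ : CommRing S') (_ : IsRegularLocalRing S') (_ : Algebra (S (i + 1)) S')
            (_ : IsLocalHom (algebraMap (S (i + 1)) S')) (_ : Algebra.FormallySmooth (S (i + 1)) S')
            (_ : Algebra.EssFiniteType (S (i + 1)) S') (e : Localization.AtPrime 𝔫 ≃+* S'),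
            e (algebraMap (cobordantAlgebra' u w) (Localization.AtPrime 𝔫) g) = algebraMap (S (i + 1)) S' (f (i + 1))) :
    ¬ LocalWeightedDropEFT3 p := by
  rintro ⟨ι, J, h6, -, -, -, -, h11, hgame, -, -, -⟩
  exact canonicalGameClause_false_of_forcedMinimalDescentChain p ι J h6 h11 k₀ S f hf0 hf2 hchain hgame

/-- Corollary: a forced descent chain through minimal moves in characteristic `p` refutes the registered key H2a⁗
`LocalWeightedDropEFT4S p` — via the by-name seam `not_eft4S_of_not_eft3` (p508387). [folklore] -/
theorem localWeightedDropEFT4S_false_of_forcedMinimalDescentChain (p : ℕ)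
    (k₀ : Type) [Field k₀] [CharP k₀ p] [PerfectField k₀]
    (S : ℕ → Type) [∀ i, CommRing (S i)] [∀ i, Algebra k₀ (S i)] [∀ i, Algebra.EssFiniteType k₀ (S i)]
    [∀ i, IsRegularLocalRing (S i)] (f : ∀ i, S i) (hf0 : ∀ i, f i ≠ 0) (hf2 : ∀ i, f i ∈ (maximalIdeal (S i)) ^ 2)
    (hchain : ∀ (i : ℕ) (P : Ideal (S i)) (n : ℕ) (u : Fin n → S i) (w : Fin n → ℕ),
      P.IsPrime → IsRegularLocalRing (S i ⧸ P) → f i ∈ P →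
      Ideal.span (Set.range u) = maximalIdeal (S i) → (maximalIdeal (S i)).spanFinrank = n → (∃ j, 0 < w j) →
      Ideal.span {x | ∃ j, 0 < w j ∧ x = u j} = P →
      (∀ (Q : Ideal (S i)) [Q.IsPrime], P ≤ Q →
        algebraMap (S i) (Localization.AtPrime Q) (f i) ∈ (maximalIdeal (Localization.AtPrime Q)) ^ 2) →
      ∃ (𝔫 : Ideal (cobordantAlgebra' u w)) (_ : 𝔫.IsPrime),
        cobordantT' u w ∈ 𝔫 ∧ P.map (algebraMap (S i) (cobordantAlgebra' u w)) ≤ 𝔫 ∧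
        ¬ (extReesAlgebra.vertexIdeal (weightedMonomialIdeal u w) ≤ 𝔫) ∧
        ∃ (a : ℕ) (g : cobordantAlgebra' u w),
          algebraMap (S i) (cobordantAlgebra' u w) (f i) = cobordantT' u w ^ a * g ∧ ¬ (cobordantT' u w ∣ g) ∧
          algebraMap (cobordantAlgebra' u w) (Localization.AtPrime 𝔫) g ∈ (maximalIdeal (Localization.AtPrime 𝔫)) ^ 2 ∧
          ∃ (S' : Type) (_ : CommRing S') (_ : IsRegularLocalRing S') (_ : Algebra (S (i + 1)) S')
            (_ : IsLocalHom (algebraMap (S (i + 1)) S')) (_ : Algebra.FormallySmooth (S (i + 1)) S')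
            (_ : Algebra.EssFiniteType (S (i + 1)) S') (e : Localization.AtPrime 𝔫 ≃+* S'),
            e (algebraMap (cobordantAlgebra' u w) (Localization.AtPrime 𝔫) g) = algebraMap (S (i + 1)) S' (f (i + 1))) :
    ¬ LocalWeightedDropEFT4S p :=
  not_eft4S_of_not_eft3 p
    (localWeightedDropEFT3_false_of_forcedMinimalDescentChain p k₀ S f hf0 hf2 hchain)

/-- **A non-empty family of singular e.f.t. positions closed under answering MINIMAL moves kills the canonical game clause**
for every `(ι, J)` with (c6) and (c11) (RULING (D15) form of tri-1's `canonicalGameClause_false_of_closedFamily`).  `F S f` is the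
membership predicate; `hclosed` says members are singular (`0 ≠ f ∈ 𝔪²`) and every move the clause can play at a member — prime
`P ∋ f` with `S ⧸ P` regular, MINIMAL system `u` of `𝔪` (`span (range u) = 𝔪`, `𝔪.spanFinrank = n`), weights not all zero whose
positively weighted members span `P`, (adm) `f ∈ 𝔪_Q²` for every prime `Q ⊇ P` — has a singular successor off the vertex over the
centre whose position is, up to a ring isomorphism, an essentially smooth local pull-back of SOME member.  Proof: a member of least
`ι`-value receives from (c9′) such a move with the `ι`-drop at all its singular successors, and from `hclosed` a successor carrying the
`ι`-value of a member ((c6) + (c11)) — contradiction with `WellFounded.not_lt_min`. [folklore] -/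
theorem canonicalGameClause_false_of_closedMinimalFamily (p : ℕ) (ι : (R : Type) → [CommRing R] → R → Ordinal.{0})
    (J : (R : Type) → [CommRing R] → R → ℕ → Ideal R)
    (h6 : IotaIsoInvariant ι) (h11 : IotaJEssSmoothCompatible ι J)
    (k₀ : Type) [Field k₀] [CharP k₀ p] [PerfectField k₀]
    (F : (S : Type) → [CommRing S] → [Algebra k₀ S] → S → Prop)
    (hne : ∃ (S : Type) (_ : CommRing S) (_ : Algebra k₀ S) (_ : Algebra.EssFiniteType k₀ S) (_ : IsRegularLocalRing S)
      (f : S), F S f)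
    (hclosed : ∀ (S : Type) [CommRing S] [Algebra k₀ S] [Algebra.EssFiniteType k₀ S] [IsRegularLocalRing S] (f : S), F S f →
      f ≠ 0 ∧ f ∈ (maximalIdeal S) ^ 2 ∧
      ∀ (P : Ideal S) (n : ℕ) (u : Fin n → S) (w : Fin n → ℕ),
        P.IsPrime → IsRegularLocalRing (S ⧸ P) → f ∈ P →
        Ideal.span (Set.range u) = maximalIdeal S → (maximalIdeal S).spanFinrank = n → (∃ j, 0 < w j) →
        Ideal.span {x | ∃ j, 0 < w j ∧ x = u j} = P →
        (∀ (Q : Ideal S) [Q.IsPrime], P ≤ Q →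
          algebraMap S (Localization.AtPrime Q) f ∈ (maximalIdeal (Localization.AtPrime Q)) ^ 2) →
        ∃ (𝔫 : Ideal (cobordantAlgebra' u w)) (_ : 𝔫.IsPrime),
          cobordantT' u w ∈ 𝔫 ∧ P.map (algebraMap S (cobordantAlgebra' u w)) ≤ 𝔫 ∧
          ¬ (extReesAlgebra.vertexIdeal (weightedMonomialIdeal u w) ≤ 𝔫) ∧
          ∃ (a : ℕ) (g : cobordantAlgebra' u w),
            algebraMap S (cobordantAlgebra' u w) f = cobordantT' u w ^ a * g ∧ ¬ (cobordantT' u w ∣ g) ∧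
            algebraMap (cobordantAlgebra' u w) (Localization.AtPrime 𝔫) g ∈ (maximalIdeal (Localization.AtPrime 𝔫)) ^ 2 ∧
            ∃ (S₁ : Type) (_ : CommRing S₁) (_ : Algebra k₀ S₁) (_ : Algebra.EssFiniteType k₀ S₁) (_ : IsRegularLocalRing S₁)
              (f₁ : S₁), F S₁ f₁ ∧
              ∃ (S' : Type) (_ : CommRing S') (_ : IsRegularLocalRing S') (_ : Algebra S₁ S')
                (_ : IsLocalHom (algebraMap S₁ S')) (_ : Algebra.FormallySmooth S₁ S') (_ : Algebra.EssFiniteType S₁ S')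
                (e : Localization.AtPrime 𝔫 ≃+* S'),
                e (algebraMap (cobordantAlgebra' u w) (Localization.AtPrime 𝔫) g) = algebraMap S₁ S' f₁) :
    ¬ CanonicalGameClause p ι J := by
  intro hgame
  set A : Set Ordinal.{0} := {α | ∃ (S : Type) (_ : CommRing S) (_ : Algebra k₀ S) (_ : Algebra.EssFiniteType k₀ S)
    (_ : IsRegularLocalRing S) (f : S), F S f ∧ ι S f = α} with hA_def
  have wf : WellFounded ((· < ·) : Ordinal.{0} → Ordinal.{0} → Prop) := wellFounded_lt
  have hA : A.Nonempty := by
    obtain ⟨S, _, _, _, _, f, hF⟩ := hne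
    exact ⟨ι S f, S, inferInstance, inferInstance, inferInstance, inferInstance, f, hF, rfl⟩
  obtain ⟨S, _, _, _, _, f, hF, hα⟩ := wf.min_mem A hA
  obtain ⟨hf0, hf2, hmoves⟩ := hclosed S f hF
  obtain ⟨P, hP, hPreg, hfP, -, -, n, u, w, hspan, hrank, hpos, hcentre, -, hadm, hdrop⟩ := hgame k₀ S f hf0 hf2
  obtain ⟨𝔫, h𝔫, ht, hP𝔫, hv, a, g, hfg, hndvd, hg2, S₁, _, _, _, _, f₁, hF₁, S', _, _, _, _, _, _, e, he⟩ :=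
    hmoves P n u w hP hPreg hfP hspan hrank hpos hcentre (fun Q _ hQ => hadm Q hQ)
  have h := hdrop 𝔫 ht hP𝔫 hv a g hfg hndvd hg2
  have h1 : ι S' (e (algebraMap (cobordantAlgebra' u w) (Localization.AtPrime 𝔫) g)) =
      ι (Localization.AtPrime 𝔫) (algebraMap (cobordantAlgebra' u w) (Localization.AtPrime 𝔫) g) :=
    h6 (Localization.AtPrime 𝔫) S' e (algebraMap (cobordantAlgebra' u w) (Localization.AtPrime 𝔫) g)
  have h2 : ι S' (algebraMap S₁ S' f₁) = ι S₁ f₁ := (h11 S₁ S' f₁).1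
  rw [← h1, he, h2, hα] at h
  have hmem : ι S₁ f₁ ∈ A := ⟨S₁, inferInstance, inferInstance, inferInstance, inferInstance, f₁, hF₁, rfl⟩
  exact wf.not_lt_min A hmem h

/-- Corollary: a non-empty family of singular e.f.t. positions in characteristic `p` closed under answering minimal moves refutes
H2a‴ `LocalWeightedDropEFT3 p`. [folklore] -/
theorem localWeightedDropEFT3_false_of_closedMinimalFamily (p : ℕ)
    (k₀ : Type) [Field k₀] [CharP k₀ p] [PerfectField k₀]
    (F : (S : Type) → [CommRing S] → [Algebra k₀ S] → S → Prop)
    (hne : ∃ (S : Type) (_ : CommRing S) (_ : Algebra k₀ S) (_ : Algebra.EssFiniteType k₀ S) (_ : IsRegularLocalRing S)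
      (f : S), F S f)
    (hclosed : ∀ (S : Type) [CommRing S] [Algebra k₀ S] [Algebra.EssFiniteType k₀ S] [IsRegularLocalRing S] (f : S), F S f →
      f ≠ 0 ∧ f ∈ (maximalIdeal S) ^ 2 ∧
      ∀ (P : Ideal S) (n : ℕ) (u : Fin n → S) (w : Fin n → ℕ),
        P.IsPrime → IsRegularLocalRing (S ⧸ P) → f ∈ P →
        Ideal.span (Set.range u) = maximalIdeal S → (maximalIdeal S).spanFinrank = n → (∃ j, 0 < w j) →
        Ideal.span {x | ∃ j, 0 < w j ∧ x = u j} = P →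
        (∀ (Q : Ideal S) [Q.IsPrime], P ≤ Q →
          algebraMap S (Localization.AtPrime Q) f ∈ (maximalIdeal (Localization.AtPrime Q)) ^ 2) →
        ∃ (𝔫 : Ideal (cobordantAlgebra' u w)) (_ : 𝔫.IsPrime),
          cobordantT' u w ∈ 𝔫 ∧ P.map (algebraMap S (cobordantAlgebra' u w)) ≤ 𝔫 ∧
          ¬ (extReesAlgebra.vertexIdeal (weightedMonomialIdeal u w) ≤ 𝔫) ∧
          ∃ (a : ℕ) (g : cobordantAlgebra' u w),
            algebraMap S (cobordantAlgebra' u w) f = cobordantT' u w ^ a * g ∧ ¬ (cobordantT' u w ∣ g) ∧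
            algebraMap (cobordantAlgebra' u w) (Localization.AtPrime 𝔫) g ∈ (maximalIdeal (Localization.AtPrime 𝔫)) ^ 2 ∧
            ∃ (S₁ : Type) (_ : CommRing S₁) (_ : Algebra k₀ S₁) (_ : Algebra.EssFiniteType k₀ S₁) (_ : IsRegularLocalRing S₁)
              (f₁ : S₁), F S₁ f₁ ∧
              ∃ (S' : Type) (_ : CommRing S') (_ : IsRegularLocalRing S') (_ : Algebra S₁ S')
                (_ : IsLocalHom (algebraMap S₁ S')) (_ : Algebra.FormallySmooth S₁ S') (_ : Algebra.EssFiniteType S₁ S')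
                (e : Localization.AtPrime 𝔫 ≃+* S'),
                e (algebraMap (cobordantAlgebra' u w) (Localization.AtPrime 𝔫) g) = algebraMap S₁ S' f₁) :
    ¬ LocalWeightedDropEFT3 p := by
  rintro ⟨ι, J, h6, -, -, -, -, h11, hgame, -, -, -⟩
  exact canonicalGameClause_false_of_closedMinimalFamily p ι J h6 h11 k₀ F hne hclosed hgame

/-- Corollary: a non-empty family of singular e.f.t. positions in characteristic `p` closed under answering minimal moves refutes
the registered key H2a⁗ `LocalWeightedDropEFT4S p` — via the by-name seam `not_eft4S_of_not_eft3` (p508387). [folklore] -/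
theorem localWeightedDropEFT4S_false_of_closedMinimalFamily (p : ℕ)
    (k₀ : Type) [Field k₀] [CharP k₀ p] [PerfectField k₀]
    (F : (S : Type) → [CommRing S] → [Algebra k₀ S] → S → Prop)
    (hne : ∃ (S : Type) (_ : CommRing S) (_ : Algebra k₀ S) (_ : Algebra.EssFiniteType k₀ S) (_ : IsRegularLocalRing S)
      (f : S), F S f)
    (hclosed : ∀ (S : Type) [CommRing S] [Algebra k₀ S] [Algebra.EssFiniteType k₀ S] [IsRegularLocalRing S] (f : S), F S f →
      f ≠ 0 ∧ f ∈ (maximalIdeal S) ^ 2 ∧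
      ∀ (P : Ideal S) (n : ℕ) (u : Fin n → S) (w : Fin n → ℕ),
        P.IsPrime → IsRegularLocalRing (S ⧸ P) → f ∈ P →
        Ideal.span (Set.range u) = maximalIdeal S → (maximalIdeal S).spanFinrank = n → (∃ j, 0 < w j) →
        Ideal.span {x | ∃ j, 0 < w j ∧ x = u j} = P →
        (∀ (Q : Ideal S) [Q.IsPrime], P ≤ Q →
          algebraMap S (Localization.AtPrime Q) f ∈ (maximalIdeal (Localization.AtPrime Q)) ^ 2) →
        ∃ (𝔫 : Ideal (cobordantAlgebra' u w)) (_ : 𝔫.IsPrime),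
          cobordantT' u w ∈ 𝔫 ∧ P.map (algebraMap S (cobordantAlgebra' u w)) ≤ 𝔫 ∧
          ¬ (extReesAlgebra.vertexIdeal (weightedMonomialIdeal u w) ≤ 𝔫) ∧
          ∃ (a : ℕ) (g : cobordantAlgebra' u w),
            algebraMap S (cobordantAlgebra' u w) f = cobordantT' u w ^ a * g ∧ ¬ (cobordantT' u w ∣ g) ∧
            algebraMap (cobordantAlgebra' u w) (Localization.AtPrime 𝔫) g ∈ (maximalIdeal (Localization.AtPrime 𝔫)) ^ 2 ∧
            ∃ (S₁ : Type) (_ : CommRing S₁) (_ : Algebra k₀ S₁) (_ : Algebra.EssFiniteType k₀ S₁) (_ : IsRegularLocalRing S₁)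
              (f₁ : S₁), F S₁ f₁ ∧
              ∃ (S' : Type) (_ : CommRing S') (_ : IsRegularLocalRing S') (_ : Algebra S₁ S')
                (_ : IsLocalHom (algebraMap S₁ S')) (_ : Algebra.FormallySmooth S₁ S') (_ : Algebra.EssFiniteType S₁ S')
                (e : Localization.AtPrime 𝔫 ≃+* S'),
                e (algebraMap (cobordantAlgebra' u w) (Localization.AtPrime 𝔫) g) = algebraMap S₁ S' f₁) :
    ¬ LocalWeightedDropEFT4S p :=
  not_eft4S_of_not_eft3 p (localWeightedDropEFT3_false_of_closedMinimalFamily p k₀ F hne hclosed)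

end Summit.ResolutionOfSingularities.ResolutionOfSingularities.Theorems.HypersurfaceCentreConstruction.Negative

end
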